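import Literature.NumberTheory.Sieve.BombieriAsymptoticSieveSmoothPart
import Literature.NumberTheory.Sieve.BombieriAsymptoticSieveMertens
import Mathlib.Analysis.SpecialFunctions.Pow.Real
import Mathlib.Analysis.SpecialFunctions.Log.Basic
import Mathlib.Analysis.SpecificLimits.Basic
import HarnessLib

/-!
# Smooth and rough parts of an integer; Rankin's trick with multiplicative weights

Topic `Literature/NumberTheory/Sieve`.  Source-independent tools for Hooley's method
(*On the distribution of the roots of polynomial congruences*, Mathematika 11 (1964) 39–49, as
outlined in Martin–Sitar, Mathematika 57 (2011) §3.2: every modulus `k ≤ x` is factored as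
`k = k₁ k₂` with `k₁` composed of the primes below a parameter and `k₂` of the primes above it,
and the `k` with a large smooth part `k₁` are discarded by a Rankin-type bound, Hooley's Lemma 7).
Everything here is elementary and PROVED; nothing refers to polynomial congruences.

* the smooth part `k₁ = Literature.smoothPart N k = ∏_{p ∣ k, p < N} p^{v_p(k)}` is the tree's
  (`BombieriAsymptoticSieveSmoothPart.lean`, with `smoothPart_mul_div`, `coprime_smoothPart_div`,
  `smoothPart_mul_eq`); the rough part is the cofactor `k₂ = k / smoothPart N k`, all of whose
  prime factors are `≥ N` (`le_of_prime_dvd_div_smoothPart`);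
* `roughIcc N t` — the finset of `1 ≤ b ≤ t` all of whose prime factors are `≥ N` (NOT Mathlib's
  `Nat.roughNumbersUpTo`, which is the complement of the smooth numbers), and the rearrangement
  `sum_Icc_eq_sum_smooth_sum_rough`:
  `∑_{1 ≤ k ≤ x} F(k) = ∑_{a ≤ x, a N-smooth} ∑_{b ∈ roughIcc N (x/a)} F(a b)`
  (the map `k ↦ (k₁, k₂)` is a bijection onto the pairs with `k₁ k₂ ≤ x`), and the fibre bound
  `card_filter_smoothPart_eq_le`: `#{k ≤ x : k₁ = a} ≤ x/a`;
* `card_primeFactors_mul_log_le` — for `b ≠ 0` with all prime factors `≥ z > 0`,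
  `ω(b) log z ≤ log b`;
* `sum_le_prod_tsum_of_smooth` — the Euler-product majorant
  `∑_{k ∈ S} g(k) ≤ ∏_{p < N} ∑_{a ≥ 0} g(p^a)` for `g ≥ 0` multiplicative and `S` a finite set
  of `N`-smooth numbers: the case `s = Nat.primesBelow N` of the tree's canonical majorant
  `BombieriSieve.sum_le_prod_tsum_of_factored` (`BombieriAsymptoticSieveMertens.lean`, sums over
  `Nat.factoredNumbers s`), via `Nat.smoothNumbers_eq_factoredNumbers_primesBelow`;
* `sum_div_le_rankin` — **Rankin's trick with multiplicative weights**: for `g ≥ 0`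
  multiplicative with `g(p^a) ≤ W` on prime powers, `0 ≤ η ≤ 1/3`, `z > 0`,
  `∑_{k ∈ S, k > z} g(k)/k ≤ z^{-η} exp(∑_{p < N} (g(p) p^{η-1} + 4 W p^{2η-2}))`,
  and its case `η = 0`, `sum_div_le_exp_of_smooth`:
  `∑_{k ∈ S} g(k)/k ≤ exp(∑_{p < N} (g(p)/p + 4 W / p²))`
  (Montgomery–Vaughan, *Multiplicative Number Theory I*, §7.1, the method of Rankin (1938);
  de Bruijn; cf. the tree's `RankinSmoothNumbers.lean` for the unweighted case).

## Search note (rough numbers in Mathlib and in the tree)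

"`z`-rough" objects already in the tree, and why `roughIcc` is nevertheless kept: the predicate
`Literature.BFI.IsRough z n := ∀ p ∈ n.primeFactors, z ≤ p` (`BombieriFriedlanderIwaniecDyadic.lean`, real
threshold; `roughIcc ⌈z⌉₊ t` is the filter of `Icc 1 t` by it — not imported here, to keep this
file's closure light), the rough part `BombieriSieve.SigmaZero.roughPart w n`
(`BombieriAsymptoticSieveSigma0.lean`, real threshold; here the cofactor `k / smoothPart N k` is used
instead, so that no second "part" definition is introduced), the inline sieve finset
`(Ioc 0 ⌊x⌋₊).filter (·.Coprime (primesProdBelow z))` of `BombieriSieve.sum_inv_rough_le`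
(`BombieriAsymptoticSieveMertens.lean`; equal to `roughIcc ⌈z⌉₊ ⌊x⌋₊`, `roughIcc_ceil_eq` below —
the bridge through which the sieve bounds of `RoughNumbersInProgressions.lean` are applied), and
Mathlib's `Nat.factoredNumbers s` (`mem_roughIcc_iff_mem_factoredNumbers` below:
`b ∈ roughIcc N t ↔ b ∈ Icc 1 t ∧ b ∈ Nat.factoredNumbers ((Nat.primesLE t).filter (N ≤ ·))`).
`roughIcc N t` is kept as a separate finset because the smooth–rough decomposition of the moduli
is indexed by the INTEGER threshold `N` of `Nat.smoothNumbers N` / `Literature.smoothPart N`, must contain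
`1`, and is summed over (a `Finset`, not a predicate or a `Set`).  Mathlib's `Nat.roughNumbersUpTo`
is a different object (the complement of the smooth numbers).

## References

* C. Hooley, Mathematika 11 (1964) 39–49, Lemma 7 (per [cite: MartinSitar2010, §3.2]: "his
  Lemma 7–Lemma 8 make no reference to the polynomial"; original not held).
  [cite: Hooley1964, Lemma 7 (per MartinSitar2010 §3.2)]
* H. L. Montgomery, R. C. Vaughan, *Multiplicative Number Theory I*, CUP 2007, §7.1
  (Rankin's method, eq. (7.17), PDF p. 160 of the held copy). [cite: MontgomeryVaughan2007, §7.1 eq. (7.17)]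
-/

noncomputable section

open Finset

namespace Literature.NumberTheory.Sieve

/-! ### The rough cofactor `k / smoothPart N k` -/

/-- Every prime factor of the cofactor `k / smoothPart N k` is `≥ N` (`k ≠ 0`). [folklore] -/
theorem le_of_prime_dvd_div_smoothPart {N k p : ℕ} (hk : k ≠ 0) (hp : p.Prime)
    (h : p ∣ k / smoothPart N k) : N ≤ p :=
  not_lt.1 fun hlt => not_dvd_div_smoothPart hp hlt hk h

/-- The cofactor `k / smoothPart N k` is positive for `k ≠ 0`. [folklore] -/
theorem div_smoothPart_pos {N k : ℕ} (hk : k ≠ 0) : 0 < k / smoothPart N k := by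
  refine Nat.pos_of_ne_zero fun h0 => hk ?_
  rw [← smoothPart_mul_div hk N, h0, mul_zero]

/-- Two naturals whose prime factors lie on opposite sides of `N` are coprime. [folklore] -/
theorem coprime_of_primeFactors_lt_of_le {N a b : ℕ}
    (ha : ∀ p : ℕ, p.Prime → p ∣ a → p < N) (hb : ∀ p : ℕ, p.Prime → p ∣ b → N ≤ p) :
    Nat.Coprime a b := by
  rw [Nat.coprime_iff_gcd_eq_one]
  by_contra h
  obtain ⟨p, hp, hpd⟩ := Nat.exists_prime_and_dvd h
  have h1 := ha p hp (hpd.trans (Nat.gcd_dvd_left _ _))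
  have h2 := hb p hp (hpd.trans (Nat.gcd_dvd_right _ _))
  omega

/-! ### Rough numbers up to `t` and the double-sum decomposition -/

/-- `roughIcc N t`: the finset of `1 ≤ b ≤ t` all of whose prime factors are `≥ N` (it contains
`1`).  This is the set of "`N`-rough" numbers of sieve theory — not to be confused with Mathlib's
`Nat.roughNumbersUpTo`, the complement of the `N`-smooth numbers. [folklore] -/
def roughIcc (N t : ℕ) : Finset ℕ := (Icc 1 t).filter fun b => ∀ p ∈ b.primeFactors, N ≤ p

/-- Membership in `roughIcc`. [folklore] -/
theorem mem_roughIcc {N t b : ℕ} :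
    b ∈ roughIcc N t ↔ (1 ≤ b ∧ b ≤ t) ∧ ∀ p : ℕ, p.Prime → p ∣ b → N ≤ p := by
  rw [roughIcc, mem_filter, mem_Icc]
  refine and_congr_right fun hb => ⟨fun h p hp hpb => h p ?_, fun h p hp => ?_⟩
  · exact Nat.mem_primeFactors.2 ⟨hp, hpb, by omega⟩
  · exact h p (Nat.prime_of_mem_primeFactors hp) (Nat.dvd_of_mem_primeFactors hp)

/-- `roughIcc` is monotone in `t`. [folklore] -/
theorem roughIcc_mono (N : ℕ) {t t' : ℕ} (h : t ≤ t') : roughIcc N t ⊆ roughIcc N t' := by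
  intro b hb
  rw [mem_roughIcc] at hb ⊢
  exact ⟨⟨hb.1.1, hb.1.2.trans h⟩, hb.2⟩

/-- `roughIcc N t ⊆ Icc 1 t`. [folklore] -/
theorem roughIcc_subset_Icc (N t : ℕ) : roughIcc N t ⊆ Icc 1 t := Finset.filter_subset _ _

/-- **Bridge to Mathlib's factored numbers**: `b ∈ roughIcc N t` iff `1 ≤ b ≤ t` and every prime
factor of `b` lies in the set of primes `p ≤ t` with `N ≤ p`. [folklore] -/
theorem mem_roughIcc_iff_mem_factoredNumbers {N t b : ℕ} :
    b ∈ roughIcc N t ↔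
      b ∈ Icc 1 t ∧ b ∈ Nat.factoredNumbers ((Nat.primesLE t).filter (fun p => N ≤ p)) := by
  rw [mem_roughIcc, mem_Icc, Nat.mem_factoredNumbers']
  refine and_congr_right fun hb => ⟨fun h p hp hpb => ?_, fun h p hp hpb => ?_⟩
  · rw [Finset.mem_filter, Nat.mem_primesLE]
    exact ⟨⟨(Nat.le_of_dvd (by omega) hpb).trans hb.2, hp⟩, h p hp hpb⟩
  · exact (Finset.mem_filter.1 (h p hp hpb)).2

/-- **Bridge to the sieve files**: for `N = ⌈z⌉₊` the `N`-rough numbers `1 ≤ b ≤ t` are the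
`0 < b ≤ t` prime to `P(z) = ∏_{p < z} p` (`Literature.primesProdBelow z`), the inline finset of
`BombieriSieve.sum_inv_rough_le` and of `RoughNumbersInProgressions.lean`. [folklore] -/
theorem roughIcc_ceil_eq (z : ℝ) (t : ℕ) :
    roughIcc ⌈z⌉₊ t = (Ioc 0 t).filter (fun n : ℕ => n.Coprime (primesProdBelow z)) := by
  ext b
  rw [mem_roughIcc, mem_filter, mem_Ioc, coprime_primesProdBelow_iff]
  constructor
  · rintro ⟨⟨hb1, hbt⟩, hr⟩
    refine ⟨⟨hb1, hbt⟩, fun q hq hqb => ?_⟩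
    obtain ⟨hqN, hqp⟩ := Nat.mem_primesBelow.1 hq
    exact absurd (hr q hqp hqb) (not_le.2 hqN)
  · rintro ⟨⟨hb1, hbt⟩, hr⟩
    refine ⟨⟨hb1, hbt⟩, fun p hp hpb => ?_⟩
    by_contra hlt
    exact hr p (Nat.mem_primesBelow.2 ⟨not_le.1 hlt, hp⟩) hpb

/-- The prime factors of a `⌈z⌉₊`-rough number are `≥ z` (as real numbers). [folklore] -/
theorem le_of_mem_roughIcc_ceil {z : ℝ} {t b : ℕ} (hb : b ∈ roughIcc ⌈z⌉₊ t) :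
    ∀ p ∈ b.primeFactors, z ≤ (p : ℝ) := by
  intro p hp
  have h := (mem_roughIcc.1 hb).2 p (Nat.prime_of_mem_primeFactors hp) (Nat.dvd_of_mem_primeFactors hp)
  exact (Nat.le_ceil z).trans (by exact_mod_cast h)

/-- An `N`-smooth `a` and an `N`-rough `b` are coprime. [folklore] -/
theorem coprime_of_smooth_of_mem_roughIcc {N a t b : ℕ} (ha : a ∈ Nat.smoothNumbers N)
    (hb : b ∈ roughIcc N t) : a.Coprime b :=
  coprime_of_primeFactors_lt_of_le (fun p hp hpa => (Nat.mem_smoothNumbers'.1 ha) p hp hpa)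
    (mem_roughIcc.1 hb).2

/-- The rough cofactor of `k ≤ x` lies in `roughIcc N (x / smoothPart N k)`. [folklore] -/
theorem div_smoothPart_mem_roughIcc {N k x : ℕ} (hk : k ≠ 0) (hkx : k ≤ x) :
    k / smoothPart N k ∈ roughIcc N (x / smoothPart N k) := by
  rw [mem_roughIcc]
  exact ⟨⟨div_smoothPart_pos hk, Nat.div_le_div_right hkx⟩,
    fun p hp h => le_of_prime_dvd_div_smoothPart hk hp h⟩

/-- The smooth part of `k ≤ x` lies in `Nat.smoothNumbersUpTo x N`. [folklore] -/
theorem smoothPart_mem_smoothNumbersUpTo {N k x : ℕ} (hk : k ≠ 0) (hkx : k ≤ x) :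
    smoothPart N k ∈ Nat.smoothNumbersUpTo x N := by
  rw [Nat.mem_smoothNumbersUpTo]
  exact ⟨(Nat.le_of_dvd (Nat.pos_of_ne_zero hk) (smoothPart_dvd hk N)).trans hkx,
    smoothPart_mem_smoothNumbers N k⟩

/-- **Sorting `1 ≤ k ≤ x` by its `N`-smooth part**:
`∑_{1 ≤ k ≤ x} F(k) = ∑_{a ≤ x, a N-smooth} ∑_{b ∈ roughIcc N (x / a)} F(a b)`
(the map `k ↦ (k₁, k₂)` is a bijection onto the pairs with `k₁ k₂ ≤ x`). [folklore] -/
theorem sum_Icc_eq_sum_smooth_sum_rough {M : Type*} [AddCommMonoid M] (F : ℕ → M) (N x : ℕ) :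
    ∑ k ∈ Icc 1 x, F k =
      ∑ a ∈ Nat.smoothNumbersUpTo x N, ∑ b ∈ roughIcc N (x / a), F (a * b) := by
  rw [Finset.sum_sigma']
  refine Finset.sum_bij' (fun k _ => ⟨smoothPart N k, k / smoothPart N k⟩) (fun ab _ => ab.1 * ab.2)
    ?_ ?_ ?_ ?_ ?_
  · intro k hk
    rw [mem_Icc] at hk
    have hk0 : k ≠ 0 := by omega
    exact mem_sigma.2 ⟨smoothPart_mem_smoothNumbersUpTo hk0 hk.2, div_smoothPart_mem_roughIcc hk0 hk.2⟩
  · rintro ⟨a, b⟩ hab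
    rw [mem_sigma, Nat.mem_smoothNumbersUpTo, mem_roughIcc] at hab
    obtain ⟨⟨-, ha⟩, ⟨hb1, hbt⟩, -⟩ := hab
    have ha0 : a ≠ 0 := Nat.ne_zero_of_mem_smoothNumbers ha
    rw [mem_Icc]
    refine ⟨Nat.one_le_iff_ne_zero.2 (mul_ne_zero ha0 (by omega)), ?_⟩
    rw [Nat.le_div_iff_mul_le (Nat.pos_of_ne_zero ha0)] at hbt
    rw [mul_comm]; exact hbt
  · intro k hk
    rw [mem_Icc] at hk
    exact smoothPart_mul_div (by omega) N
  · rintro ⟨a, b⟩ hab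
    rw [mem_sigma, Nat.mem_smoothNumbersUpTo, mem_roughIcc] at hab
    obtain ⟨⟨-, ha⟩, ⟨hb1, -⟩, hb⟩ := hab
    have ha0 : a ≠ 0 := Nat.ne_zero_of_mem_smoothNumbers ha
    have hb0 : b ≠ 0 := Nat.one_le_iff_ne_zero.1 hb1
    have h1 : smoothPart N (a * b) = a :=
      smoothPart_mul_eq ha hb0 fun p hp hpN hpb => absurd (hb p hp hpb) (not_le.2 hpN)
    have h2 : a * b / a = b := Nat.mul_div_cancel_left b (Nat.pos_of_ne_zero ha0)
    simp only [h1, h2]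
  · intro k hk
    rw [mem_Icc] at hk
    dsimp only
    rw [smoothPart_mul_div (by omega) N]

/-- **The fibres of the smooth part are small**:
`#{1 ≤ k ≤ x : smoothPart N k = a} ≤ x / a` (such `k` are multiples of `a`). [folklore] -/
theorem card_filter_smoothPart_eq_le (N x a : ℕ) :
    #((Icc 1 x).filter fun k => smoothPart N k = a) ≤ x / a := by
  calc #((Icc 1 x).filter fun k => smoothPart N k = a)
      ≤ #((Icc 1 x).filter fun k => a ∣ k) := by
        refine Finset.card_le_card (Finset.monotone_filter_right _ fun k hk h => ?_)
        rw [mem_Icc] at hk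
        rw [← h]
        exact smoothPart_dvd (by omega) N
    _ = x / a := by
        rw [show Icc 1 x = Ioc 0 x from Finset.Icc_succ_left_eq_Ioc 0 x]
        exact Nat.Ioc_filter_dvd_card_eq_div x a

/-! ### Rough numbers have few prime factors -/

/-- For `b ≠ 0` all of whose prime factors are `≥ z > 0`: `ω(b) · log z ≤ log b`
(since `z^{ω(b)} ≤ ∏_{p ∣ b} p ≤ b`). [folklore] -/
theorem card_primeFactors_mul_log_le {z : ℝ} (hz : 0 < z) {b : ℕ} (hb : b ≠ 0)
    (h : ∀ p ∈ b.primeFactors, z ≤ (p : ℝ)) :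
    (b.primeFactors.card : ℝ) * Real.log z ≤ Real.log b := by
  have h1 : z ^ b.primeFactors.card ≤ ((∏ p ∈ b.primeFactors, p : ℕ) : ℝ) := by
    rw [Nat.cast_prod, ← Finset.prod_const]
    exact Finset.prod_le_prod (fun _ _ => hz.le) h
  have h2 : ((∏ p ∈ b.primeFactors, p : ℕ) : ℝ) ≤ b := by
    exact_mod_cast Nat.le_of_dvd (Nat.pos_of_ne_zero hb) (Nat.prod_primeFactors_dvd b)
  have h3 : z ^ b.primeFactors.card ≤ (b : ℝ) := h1.trans h2
  have hb0 : (0 : ℝ) < b := by exact_mod_cast Nat.pos_of_ne_zero hb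
  rw [← Real.log_pow]
  exact Real.log_le_log (pow_pos hz _) h3

/-! ### Euler-product majorants and Rankin's trick -/

/-- **Euler-product majorant for sums over smooth numbers.**  For `g ≥ 0` on `ℕ` with `g 1 = 1`,
multiplicative on coprime arguments and with summable prime-power series, every finite sum of
`g` over `N`-smooth numbers is at most `∏_{p < N} ∑_{a ≥ 0} g(p^a)`.  The case
`s = Nat.primesBelow N` of the tree's `BombieriSieve.sum_le_prod_tsum_of_factored`
(`Nat.smoothNumbers N = Nat.factoredNumbers (Nat.primesBelow N)`). [folklore] -/
theorem sum_le_prod_tsum_of_smooth {g : ℕ → ℝ} (hg0 : ∀ k, 0 ≤ g k) (hg1 : g 1 = 1)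
    (hmul : ∀ {m n : ℕ}, Nat.Coprime m n → g (m * n) = g m * g n)
    (hsum : ∀ {p : ℕ}, p.Prime → Summable fun a : ℕ => g (p ^ a))
    (N : ℕ) {S : Finset ℕ} (hS : ∀ k ∈ S, k ∈ Nat.smoothNumbers N) :
    ∑ k ∈ S, g k ≤ ∏ p ∈ Nat.primesBelow N, ∑' a : ℕ, g (p ^ a) :=
  BombieriSieve.sum_le_prod_tsum_of_factored hg1 hmul hg0 hsum
    (fun _ hp => (Nat.mem_primesBelow.1 hp).2)
    (fun k hk => by rw [← Nat.smoothNumbers_eq_factoredNumbers_primesBelow]; exact hS k hk)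

/-- Bounding one Euler factor: if `0 ≤ G(p^a) ≤ W r^a` for `a ≥ 2` with `0 ≤ r ≤ 7/10`, then
`∑_{a ≥ 0} G(p^a) ≤ G(1) + G(p) + 4 W r²`. [folklore] -/
theorem tsum_prime_pow_le {G : ℕ → ℝ} {p : ℕ} {W r : ℝ} (hW : 0 ≤ W)
    (hr0 : 0 ≤ r) (hr : r ≤ 7 / 10) (hGa : ∀ a : ℕ, 2 ≤ a → G (p ^ a) ≤ W * r ^ a)
    (hsum : Summable fun a : ℕ => G (p ^ a)) :
    ∑' a : ℕ, G (p ^ a) ≤ G 1 + G p + 4 * W * r ^ 2 := by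
  have hr1 : r < 1 := by linarith
  rw [hsum.tsum_eq_zero_add, pow_zero]
  have hsum1 : Summable fun a : ℕ => G (p ^ (a + 1)) := (summable_nat_add_iff 1).2 hsum
  rw [hsum1.tsum_eq_zero_add, zero_add, pow_one]
  have hsum2 : Summable fun a : ℕ => G (p ^ (a + 1 + 1)) := (summable_nat_add_iff 1).2 hsum1
  have hgeom : Summable fun a : ℕ => W * r ^ 2 * r ^ a :=
    (summable_geometric_of_lt_one hr0 hr1).mul_left _
  have h3 : ∑' a : ℕ, G (p ^ (a + 1 + 1)) ≤ ∑' a : ℕ, W * r ^ 2 * r ^ a := by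
    refine hsum2.tsum_le_tsum (fun a => ?_) hgeom
    calc G (p ^ (a + 1 + 1)) ≤ W * r ^ (a + 1 + 1) := hGa _ (by omega)
      _ = W * r ^ 2 * r ^ a := by ring
  have h4 : ∑' a : ℕ, W * r ^ 2 * r ^ a = W * r ^ 2 * (1 - r)⁻¹ := by
    rw [tsum_mul_left, tsum_geometric_of_lt_one hr0 hr1]
  have h5 : (1 - r)⁻¹ ≤ 4 := by
    rw [inv_le_comm₀ (by linarith) (by norm_num)]
    linarith
  have h6 : W * r ^ 2 * (1 - r)⁻¹ ≤ 4 * W * r ^ 2 := by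
    have : 0 ≤ W * r ^ 2 := by positivity
    nlinarith
  linarith [add_le_add_left (h3.trans (h4.le.trans h6)) (G 1 + G p)]

/-- `∏ a_i ≤ exp(∑ u_i)` when `0 ≤ a_i ≤ 1 + u_i`. [folklore] -/
theorem prod_le_exp_sum {ι : Type*} (s : Finset ι) {a u : ι → ℝ} (ha0 : ∀ i ∈ s, 0 ≤ a i)
    (hau : ∀ i ∈ s, a i ≤ 1 + u i) : ∏ i ∈ s, a i ≤ Real.exp (∑ i ∈ s, u i) := by
  rw [Real.exp_sum]
  exact Finset.prod_le_prod ha0 fun i hi => (hau i hi).trans (by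
    have := Real.add_one_le_exp (u i); linarith)

/-- `2^{-2/3} ≤ 7/10` (as `(7/10)³ ≥ 1/4`). [folklore] -/
theorem two_rpow_neg_two_thirds_le : (2 : ℝ) ^ (-(2 / 3) : ℝ) ≤ 7 / 10 := by
  have h0 : (0 : ℝ) ≤ (2 : ℝ) ^ (-(2 / 3) : ℝ) := by positivity
  rw [← pow_le_pow_iff_left₀ h0 (by norm_num) three_ne_zero, ← Real.rpow_natCast,
    ← Real.rpow_mul (by norm_num)]
  have : (-(2 / 3) : ℝ) * ((3 : ℕ) : ℝ) = ((-2 : ℤ) : ℝ) := by push_cast; ring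
  rw [this, Real.rpow_intCast]
  norm_num

/-- **Rankin's trick with multiplicative weights.**  Let `g ≥ 0` be multiplicative on coprime
arguments with `g 1 = 1` and `g(p^a) ≤ W` on prime powers (`a ≥ 1`).  Then for `0 ≤ η ≤ 1/3`,
`z > 0` and any finite set `S` of `N`-smooth numbers,
`∑_{k ∈ S, k > z} g(k)/k ≤ z^{-η} exp(∑_{p < N} (g(p) p^{η-1} + 4 W p^{2η-2}))`
(Rankin 1938; Montgomery–Vaughan §7.1: multiply by `(k/z)^η ≥ 1` and expand the Euler product,
whose factor at `p` is `1 + g(p) p^{η-1} + ∑_{a ≥ 2} g(p^a) p^{a(η-1)} ≤ 1 + g(p)p^{η-1} + 4W p^{2η-2}`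
because `p^{η-1} ≤ 2^{-2/3} ≤ 7/10`). [cite: MontgomeryVaughan2007, §7.1 eq. (7.17) ("Rankin's method"; held copy PDF p. 160)] -/
theorem sum_div_le_rankin {g : ℕ → ℝ} (hg0 : ∀ k, 0 ≤ g k) (hg1 : g 1 = 1)
    (hmul : ∀ {m n : ℕ}, Nat.Coprime m n → g (m * n) = g m * g n)
    {W : ℝ} (hW : 0 ≤ W) (hgW : ∀ p a : ℕ, p.Prime → 1 ≤ a → g (p ^ a) ≤ W)
    (N : ℕ) {η : ℝ} (hη0 : 0 ≤ η) (hη : η ≤ 1 / 3) {z : ℝ} (hz : 0 < z)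
    {S : Finset ℕ} (hS : ∀ k ∈ S, k ∈ Nat.smoothNumbers N) :
    ∑ k ∈ S.filter (fun k : ℕ => z < (k : ℝ)), g k / k ≤
      z ^ (-η) * Real.exp (∑ p ∈ Nat.primesBelow N,
        (g p * (p : ℝ) ^ (η - 1) + 4 * W * (p : ℝ) ^ (2 * η - 2))) := by
  -- the Rankin weight `G(k) = g(k) k^{η-1}`
  set G : ℕ → ℝ := fun k => g k * (k : ℝ) ^ (η - 1) with hGdef
  have hG0 : ∀ k, 0 ≤ G k := fun k => mul_nonneg (hg0 k) (by positivity)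
  have hG1 : G 1 = 1 := by simp [hGdef, hg1]
  have hGmul : ∀ {m n : ℕ}, Nat.Coprime m n → G (m * n) = G m * G n := by
    intro m n hmn
    simp only [hGdef]
    rw [hmul hmn, Nat.cast_mul, Real.mul_rpow (by positivity) (by positivity)]
    ring
  -- prime powers: `G(p^a) ≤ W r^a` with `r = p^{η-1} ≤ 2^{-2/3} ≤ 7/10`
  have hGpa : ∀ {p : ℕ}, p.Prime → ∀ a : ℕ, 1 ≤ a →
      G (p ^ a) ≤ W * ((p : ℝ) ^ (η - 1)) ^ a := by
    intro p hp a ha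
    simp only [hGdef]
    rw [Nat.cast_pow, ← Real.rpow_natCast ((p : ℝ) ^ (η - 1)) a, ← Real.rpow_mul (by positivity),
      mul_comm (η - 1), Real.rpow_mul (by positivity), Real.rpow_natCast]
    exact mul_le_mul_of_nonneg_right (hgW p a hp ha) (by positivity)
  have hr0 : ∀ {p : ℕ}, 0 ≤ (p : ℝ) ^ (η - 1) := fun {p} => by positivity
  have hr : ∀ {p : ℕ}, p.Prime → (p : ℝ) ^ (η - 1) ≤ 7 / 10 := by
    intro p hp
    have h2 : (2 : ℝ) ≤ p := by exact_mod_cast hp.two_le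
    calc (p : ℝ) ^ (η - 1) ≤ (2 : ℝ) ^ (η - 1) :=
          Real.rpow_le_rpow_of_nonpos (by norm_num) h2 (by linarith)
      _ ≤ (2 : ℝ) ^ (-(2 / 3) : ℝ) := Real.rpow_le_rpow_of_exponent_le (by norm_num) (by linarith)
      _ ≤ 7 / 10 := two_rpow_neg_two_thirds_le
  have hGsum : ∀ {p : ℕ}, p.Prime → Summable fun a : ℕ => G (p ^ a) := by
    intro p hp
    have hr1 : (p : ℝ) ^ (η - 1) < 1 := by linarith [hr hp]
    refine Summable.of_nonneg_of_le (fun a => hG0 _) (fun a => ?_)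
      ((summable_geometric_of_lt_one hr0 hr1).mul_left (max 1 W))
    rcases Nat.eq_zero_or_pos a with rfl | ha
    · simp [hG1]
    · exact (hGpa hp a ha).trans (mul_le_mul_of_nonneg_right (le_max_right _ _) (by positivity))
  -- Step 1: `g(k)/k ≤ z^{-η} G(k)` for `k > z`
  have hstep : ∀ k ∈ S.filter (fun k : ℕ => z < (k : ℝ)), g k / k ≤ z ^ (-η) * G k := by
    intro k hk
    obtain ⟨-, hzk⟩ := mem_filter.1 hk
    have hk0 : (0 : ℝ) < k := hz.trans hzk
    have heq : g k / k = G k * (k : ℝ) ^ (-η) := by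
      simp only [hGdef]
      rw [mul_assoc, ← Real.rpow_add hk0, show η - 1 + -η = -1 by ring, Real.rpow_neg_one,
        div_eq_mul_inv]
    rw [heq, mul_comm]
    exact mul_le_mul_of_nonneg_right (Real.rpow_le_rpow_of_nonpos hz hzk.le (by linarith)) (hG0 k)
  -- Step 2: the Euler factors
  have hfac : ∀ p ∈ Nat.primesBelow N, ∑' a : ℕ, G (p ^ a) ≤
      1 + (g p * (p : ℝ) ^ (η - 1) + 4 * W * (p : ℝ) ^ (2 * η - 2)) := by
    intro p hp
    have hpp : p.Prime := (Nat.mem_primesBelow.1 hp).2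
    have h := tsum_prime_pow_le hW hr0 (hr hpp) (fun a ha => hGpa hpp a (by omega)) (hGsum hpp)
    have e1 : G p = g p * (p : ℝ) ^ (η - 1) := rfl
    have e2 : ((p : ℝ) ^ (η - 1)) ^ 2 = (p : ℝ) ^ (2 * η - 2) := by
      rw [← Real.rpow_natCast, ← Real.rpow_mul (by positivity)]
      norm_num
      ring_nf
    rw [hG1, e1, e2] at h
    linarith
  -- Step 3: assemble
  have hz' : 0 ≤ z ^ (-η) := by positivity
  calc ∑ k ∈ S.filter (fun k : ℕ => z < (k : ℝ)), g k / k
      ≤ ∑ k ∈ S.filter (fun k : ℕ => z < (k : ℝ)), z ^ (-η) * G k := Finset.sum_le_sum hstep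
    _ ≤ ∑ k ∈ S, z ^ (-η) * G k :=
        Finset.sum_le_sum_of_subset_of_nonneg (Finset.filter_subset _ _)
          (fun k _ _ => mul_nonneg hz' (hG0 k))
    _ = z ^ (-η) * ∑ k ∈ S, G k := by rw [Finset.mul_sum]
    _ ≤ z ^ (-η) * ∏ p ∈ Nat.primesBelow N, ∑' a : ℕ, G (p ^ a) :=
        mul_le_mul_of_nonneg_left (sum_le_prod_tsum_of_smooth hG0 hG1 hGmul hGsum N hS) hz'
    _ ≤ _ := mul_le_mul_of_nonneg_left (prod_le_exp_sum _
        (fun p _ => tsum_nonneg fun a => hG0 _) hfac) hz'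

/-- **Sums of `g(k)/k` over smooth numbers** (the case `η = 0` of `sum_div_le_rankin`): for
`g ≥ 0` multiplicative on coprime arguments with `g 1 = 1` and `g(p^a) ≤ W` on prime powers,
and any finite set `S` of `N`-smooth numbers,
`∑_{k ∈ S} g(k)/k ≤ exp(∑_{p < N} (g(p)/p + 4 W / p²))`. [folklore] -/
theorem sum_div_le_exp_of_smooth {g : ℕ → ℝ} (hg0 : ∀ k, 0 ≤ g k) (hg1 : g 1 = 1)
    (hmul : ∀ {m n : ℕ}, Nat.Coprime m n → g (m * n) = g m * g n)
    {W : ℝ} (hW : 0 ≤ W) (hgW : ∀ p a : ℕ, p.Prime → 1 ≤ a → g (p ^ a) ≤ W)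
    (N : ℕ) {S : Finset ℕ} (hS : ∀ k ∈ S, k ∈ Nat.smoothNumbers N) :
    ∑ k ∈ S, g k / k ≤
      Real.exp (∑ p ∈ Nat.primesBelow N, (g p / p + 4 * W / (p : ℝ) ^ 2)) := by
  have h := sum_div_le_rankin hg0 hg1 hmul hW hgW N le_rfl (by norm_num) one_half_pos hS
  have hfilter : S.filter (fun k : ℕ => (1 / 2 : ℝ) < (k : ℝ)) = S := by
    refine Finset.filter_true_of_mem fun k hk => ?_
    have : (1 : ℝ) ≤ k := by
      exact_mod_cast Nat.one_le_iff_ne_zero.2 (Nat.ne_zero_of_mem_smoothNumbers (hS k hk))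
    linarith
  rw [hfilter, neg_zero, Real.rpow_zero, one_mul] at h
  refine h.trans (le_of_eq ?_)
  congr 1
  refine Finset.sum_congr rfl fun p hp => ?_
  have hp0 : (0 : ℝ) < p := by exact_mod_cast (Nat.mem_primesBelow.1 hp).2.pos
  rw [zero_sub, Real.rpow_neg_one, mul_zero, zero_sub, show (-2 : ℝ) = ((-2 : ℤ) : ℝ) by norm_num,
    Real.rpow_intCast, zpow_neg, zpow_ofNat]
  ring

end Literature.NumberTheory.Sieve
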